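import Summits.CriticalPhenomena.Ising3D.TaylorTableCertE1Cells
import Summits.CriticalPhenomena.Ising3D.TaylorTableRegionBridge
import Summits.CriticalPhenomena.Ising3D.TaylorRegionDeltaTailsShiftEven
import Summits.CriticalPhenomena.Ising3D.TaylorTableRowsBridge
import Summits.CriticalPhenomena.Ising3D.TaylorTableCertE1RegionLegs
import HarnessLib

/-!
# γ-box certificate of the E1 functional, V: the HEAD-ROW LEGS — `ValidΔ` of the head files' row object from the region file set's `tab` + `rows` decides
(cell `pub-ising3x`, seat boot-1 gen 11; R17 (d) supplement (ε); generated by code/headdelta/bridge_emit.py `--rows-legs`)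

HONEST FRAMING: lottery ticket; floor = tightest certified 3D Ising CFT bounds; no exact-solution
claim without a proof. Island framing: certified exclusion region at stated derivative order and
assumptions; not a determination of the 3D Ising critical exponents beyond that.

The γ-box theorem `CertE1.boxExcluded_of_headCertsE1` takes `hVE : HE.R.ValidΔ tableE1.c tableE1.L σlo σhi εlo εhi` (and the odd
analogue `hVO`): the head files' ONE row object per sector `R = ⟨S, 40, σ0, Wσ, ε0, Wε, L⟩` (J = 40 in every head file of the replay; unread
rows blank) must be a valid δ-expansion of the functional's rows over the table box. The even region file set `e1E262144E` (kit j159151, on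
the table box; record in `TaylorTableCertE1RegionLegs`) decides exactly this for ITS record: `sizesOK`, `tabOKc TT c m` (4 × 3) and
`rowLitOKL TT L j` for every row literal `L_j` (its `LE_j`, j < 131 ⊇ j < 40 — byte-identical to the even head files' row literals, rows artefact
rows_E1_262144_even.json). `evenRowsValid_of_filesetE1` turns those Booleans (hypotheses BY NAME, with the set's literal tables `TT` and row list
`L` as variables — they are too large to land) into `hVE` for the table's weights and box via `HeadRowsΔ.validΔ_of_lit` and the landed transport
`HeadRowsΔ.validΔ_mono_agree` (`TaylorTableRowsBridge`; `l = L` and the component-wise weight agreement are `decide`d here). The odd leg needs the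
odd set ON THE TABLE BOX (kit j159425) and is appended when it lands (the /2¹⁶ odd set serves the cone only: the odd head twin fails on the
/2¹⁶ box, kit j161182). What this file shows: bookkeeping only; the `tab`/`rows` obligations are the set's kernel replay. [folklore]
-/


set_option linter.style.longLine false

namespace Summit.CriticalPhenomena.Ising3D
open Set Literature.MathematicalPhysics.QuantumFieldTheory.ConformalBootstrap3D Literature.Analysis.ValidatedNumerics

namespace CertE1

/-- **Even head-row leg**: the even file set's `sizesOK` + `tab` (4×3) + `rows` (j < 40) decides give `ValidΔ` of the head files' row object
(S, J = 40, the record's centre/half-widths, the set's row literal list `L`) w.r.t. THE TABLE's weights and box — the `hVE` hypothesis of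
`boxExcluded_of_headCertsE1` for `HE.R := ⟨S, 40, σ0, Wσ, ε0, Wε, L⟩` (via `validΔ_of_lit` + `validΔ_mono_agree`). [folklore] -/
theorem evenRowsValid_of_filesetE1 (TT : ITab3 × ITab3 × ITab3 × ITab3) (L : List (ITriple × ITriple × ITriple))
    (hs : e1E262144E.sizesOK = true) (hT : ∀ c m : ℕ, c < 4 → m < 3 → e1E262144E.tabOKc TT c m = true)
    (hr : ∀ j : ℕ, j < 40 → e1E262144E.rowLitOKL TT L j = true) :
    (⟨e1E262144E.S, 40, e1E262144E.σ0, e1E262144E.Wσ, e1E262144E.ε0, e1E262144E.Wε, L⟩ : HeadRowsΔ).ValidΔ tableE1.c tableE1.L tableE1.σlo tableE1.σhi tableE1.εlo tableE1.εhi := by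
  have h0 := HeadRowsΔ.validΔ_of_lit e1E262144E TT L 40 (by decide +kernel) hs (by decide +kernel) hT hr
  rw [show e1E262144E.l = tableE1.L from by decide +kernel] at h0
  exact HeadRowsΔ.validΔ_mono_agree _ (by decide +kernel) (by decide +kernel) (by decide +kernel) (by decide +kernel) (by decide +kernel) h0

end CertE1
end Summit.CriticalPhenomena.Ising3D
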